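import Summits.BirchSwinnertonDyer.BirchSwinnertonDyer.Theorems.PrintCFramBottomClassIndexLawFiveLeFlipRungFourierMoment
import Mathlib.LinearAlgebra.Matrix.SpecialLinearGroup
import HarnessLib

/-!
# Crux `PrintCFram.BottomClassIndexLawFiveLe` (stmt-BirchSwinnertonDyer-20372), line `eisenstein-resource-bdp-line`,
# registry v27 `stub_flipRung` — typing item T1 ↔ T3 GLUE: the flipped-cusp moment `S(n)` IN T3's SHAPE
# (cell `bsd-print-cfram`, width seat `bsd-line-cfram-p1-w6` g9; THEOREMS ONLY, `--supports` 20372; BSD is not proved by any of this)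

HONEST FRAMING. Finite Fourier analysis only; nothing about modular forms or BSD; no registered stub is closed. T3 (w4 g19,
`…FlipRungSlash.hasSum_flippedCusp_mainTerm`) writes the finite sum at the flipped cusp as
`S(n) = ∑_{j ∈ (ℤ/q²)ˣ} h(j)·cexp(2πi·(y_j/q²)·n)` over `Finset.univ.filter IsUnit`, with integers `y_j` constrained by the cusp
matrix `ω₀ = [a b; M q⁴d₀] ∈ SL₂(ℤ)` through `b − y_j·j·M = q²·c_j`; T1 (`…FlipRungFourierMoment.flipMoment_eq_int`) evaluates
the same sum written with `ZMod.stdAddChar` and the hypothesis `M²·j·y_j ≡ −1 (mod q²)`. This file is the conversion, so that T3's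
coefficient corollary (D) and T5's assembly consume T1 BY NAME with zero adapters:

* the conversion `cexp(2πi·(y/q²)·n) = ψ_{q²}(y·n)` is T3's `cexp_div_sq_mul_eq_stdAddChar` (`…FlipRungSlashCoeff`), inlined here;
* `not_dvd_of_det_flippedCusp`, `modEq_neg_one_of_det_flippedCusp`, `sq_mul_modEq_neg_one_of_flippedCusp` — from
  `det ω₀ = 1`, `ω₀₁₁ = q⁴d₀`: `q ∤ M`, `M·b ≡ −1 (mod q²)`, and `M²·j·y_j ≡ −1 (mod q²)` at every unit `j`;
* **`flipMoment_cexp_eq`** — for the Legendre weights `h = h_σ` (closed form of `sum_legendreClass_stdAddChar_eq`):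
  `S(n) = −q(q−1)/2` if `q² ∣ n`, `= (q/2)·(1 + σ·q·J(−(n/q) | q))` if `q ∥ n`, `= 0` if `q ∤ n`; and the two readings T3 (D)
  asks for: **`flipMoment_cexp_eq_zero_of_not_dvd`** (`q ∤ n ⟹ S(n) = 0`) and **`flipMoment_cexp_mul_eq`**
  (`S(q·u) = (q/2)·(1 + σ·q·J(−u | q))` for `q ∤ u`: weight `1 + q*` on the class of `σ`, `1 − q*` on the other, `q* = J(−1|q)q`).

References: LEAD g14 crux notes §2.1; T3 = `Theorems/PrintCFramBottomClassIndexLawFiveLeFlipRungSlash.lean` (w4 g19, p707746).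
beyond-print theorem: NO.
-/

set_option autoImplicit false
-- summit-side namespace `Summit.BirchSwinnertonDyer.BirchSwinnertonDyer.…` (single-conjunct summit, D-0017 layout)
set_option linter.dupNamespace false

noncomputable section

open scoped NumberTheorySymbols MatrixGroups Real
open Complex Finset

namespace Summit.BirchSwinnertonDyer.BirchSwinnertonDyer.Theorems.PrintCFram.FlipRung

variable (q : ℕ) [Fact q.Prime]

omit [Fact q.Prime] in
/-- From `det ω₀ = 1` with `ω₀₁₀ = M`, `ω₀₁₁ = q⁴d₀`: `q ∤ M` (for `q` with `q ∤ 1`, i.e. `q ≠ 1`; here `q` prime). -/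
theorem not_dvd_of_det_flippedCusp (hq : q.Prime) (ω₀ : SL(2, ℤ)) {M d₀ : ℤ} (hM : ω₀ 1 0 = M)
    (hD : ω₀ 1 1 = (q : ℤ) ^ 4 * d₀) : ¬ (q : ℤ) ∣ M := by
  have hdet := Matrix.det_fin_two (ω₀ : Matrix (Fin 2) (Fin 2) ℤ)
  rw [Matrix.SpecialLinearGroup.det_coe, hM, hD] at hdet
  rintro ⟨t, rfl⟩
  have h1 : (q : ℤ) ∣ 1 := ⟨ω₀ 0 0 * (q : ℤ) ^ 3 * d₀ - ω₀ 0 1 * t, by linear_combination hdet⟩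
  exact hq.one_lt.ne' (by exact_mod_cast Int.eq_one_of_dvd_one (by positivity) h1)

omit [Fact q.Prime] in
/-- From `det ω₀ = 1` with `ω₀₁₀ = M`, `ω₀₁₁ = q⁴d₀`: `M·ω₀₀₁ ≡ −1 (mod q²)`. -/
theorem modEq_neg_one_of_det_flippedCusp (ω₀ : SL(2, ℤ)) {M d₀ : ℤ} (hM : ω₀ 1 0 = M)
    (hD : ω₀ 1 1 = (q : ℤ) ^ 4 * d₀) : M * ω₀ 0 1 ≡ -1 [ZMOD ((q ^ 2 : ℕ) : ℤ)] := by
  have hdet := Matrix.det_fin_two (ω₀ : Matrix (Fin 2) (Fin 2) ℤ)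
  rw [Matrix.SpecialLinearGroup.det_coe, hM, hD] at hdet
  refine Int.modEq_iff_dvd.mpr ⟨-(ω₀ 0 0 * (q : ℤ) ^ 2 * d₀), ?_⟩
  push_cast
  linear_combination -hdet

omit [Fact q.Prime] in
/-- At a unit `j`, T3's constraint `ω₀₀₁ − y_j·j·M = q²·c_j` gives T1's `M²·j·y_j ≡ −1 (mod q²)`. -/
theorem sq_mul_modEq_neg_one_of_flippedCusp (ω₀ : SL(2, ℤ)) {M d₀ : ℤ} (hM : ω₀ 1 0 = M)
    (hD : ω₀ 1 1 = (q : ℤ) ^ 4 * d₀) {yj jv cj : ℤ} (hyc : ω₀ 0 1 - yj * jv * M = (q : ℤ) ^ 2 * cj) :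
    M ^ 2 * jv * yj ≡ -1 [ZMOD ((q ^ 2 : ℕ) : ℤ)] := by
  refine sq_mul_mul_modEq_neg_one (modEq_neg_one_of_det_flippedCusp q ω₀ hM hD) ?_
  refine Int.modEq_iff_dvd.mpr ⟨cj, ?_⟩
  push_cast
  linear_combination hyc

/-- **The flipped-cusp moment in T3's shape.** For an odd prime `q`, any `σ : ℤ`, the cusp matrix `ω₀ = [a b; M q⁴d₀] ∈ SL₂(ℤ)`
and integers `y_j, c_j` with `b − y_j·j·M = q²·c_j` at every unit `j mod q²` (T3's `hyc`), the sum
`S(n) = ∑_{j unit} h_σ(j)·cexp(2πi (y_j/q²) n)` with the Legendre weights `h_σ` (closed form) equals `−q(q−1)/2` if `q² ∣ n`,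
`(q/2)·(1 + σ·q·J(−(n/q) | q))` if `q ∥ n`, and `0` if `q ∤ n` (LEAD g14 crux notes §2.1; T1 `flipMoment_eq_int` at `c = M²`,
`J(−M²u | q) = J(−u | q)`). -/
theorem flipMoment_cexp_eq (hq2 : q ≠ 2) (σ : ℤ) (ω₀ : SL(2, ℤ)) {M d₀ : ℤ} (hM : ω₀ 1 0 = M)
    (hD : ω₀ 1 1 = (q : ℤ) ^ 4 * d₀) (y c : ZMod (q ^ 2) → ℤ)
    (hyc : ∀ j : ZMod (q ^ 2), IsUnit j → ω₀ 0 1 - y j * (j.val : ℤ) * M = (q : ℤ) ^ 2 * c j) (n : ℕ) :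
    ∑ j ∈ Finset.univ.filter (fun j : ZMod (q ^ 2) ↦ IsUnit j),
        ((if (q : ℤ) ∣ (j.val : ℤ) then ((q : ℂ) - 1) else -1) + σ * J(-(j.val : ℤ) | q) *
          gaussSum ((quadraticChar (ZMod q)).ringHomComp (Int.castRingHom ℂ)) (ZMod.stdAddChar (N := q))) / 2 *
          cexp (2 * π * I * ((y j : ℂ) / (q : ℂ) ^ 2) * n) =
      if (q : ℤ) ^ 2 ∣ (n : ℤ) then -((q : ℂ) * ((q : ℂ) - 1)) / 2
      else if (q : ℤ) ∣ (n : ℤ) then (q : ℂ) * (1 + σ * q * J(-((n : ℤ) / q) | q)) / 2 else 0 := by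
  have hqp : q.Prime := Fact.out
  haveI : NeZero q := ⟨hqp.ne_zero⟩
  have hqM : ¬ (q : ℤ) ∣ M := not_dvd_of_det_flippedCusp q hqp ω₀ hM hD
  have hy : ∀ j : ZMod (q ^ 2), ¬ q ∣ j.val → M ^ 2 * (j.val : ℤ) * y j ≡ -1 [ZMOD ((q ^ 2 : ℕ) : ℤ)] :=
    fun j hj ↦ sq_mul_modEq_neg_one_of_flippedCusp q ω₀ hM hD (hyc j ((isUnit_iff_not_dvd_val q j).mpr hj))
  have key := flipMoment_eq_int q hq2 σ (M ^ 2) y hy (n : ℤ)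
  rw [Finset.sum_filter]
  rw [show J(-(M ^ 2 * ((n : ℤ) / q)) | q) = J(-((n : ℤ) / q) | q) from jacobiSym_neg_sq_mul q hqp hqM _] at key
  rw [← key]
  refine Finset.sum_congr rfl fun j _ ↦ ?_
  by_cases hj : q ∣ j.val
  · rw [if_neg (fun hu ↦ (isUnit_iff_not_dvd_val q j).mp hu hj), if_pos hj]
  · rw [if_pos ((isUnit_iff_not_dvd_val q j).mpr hj), if_neg hj, ZMod.stdAddChar_coe]
    congr 2
    push_cast
    ring

/-- **T3 (D)'s first input: `q ∤ n ⟹ S(n) = 0`.** -/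
theorem flipMoment_cexp_eq_zero_of_not_dvd (hq2 : q ≠ 2) (σ : ℤ) (ω₀ : SL(2, ℤ)) {M d₀ : ℤ} (hM : ω₀ 1 0 = M)
    (hD : ω₀ 1 1 = (q : ℤ) ^ 4 * d₀) (y c : ZMod (q ^ 2) → ℤ)
    (hyc : ∀ j : ZMod (q ^ 2), IsUnit j → ω₀ 0 1 - y j * (j.val : ℤ) * M = (q : ℤ) ^ 2 * c j) {n : ℕ} (hn : ¬ q ∣ n) :
    ∑ j ∈ Finset.univ.filter (fun j : ZMod (q ^ 2) ↦ IsUnit j),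
        ((if (q : ℤ) ∣ (j.val : ℤ) then ((q : ℂ) - 1) else -1) + σ * J(-(j.val : ℤ) | q) *
          gaussSum ((quadraticChar (ZMod q)).ringHomComp (Int.castRingHom ℂ)) (ZMod.stdAddChar (N := q))) / 2 *
          cexp (2 * π * I * ((y j : ℂ) / (q : ℂ) ^ 2) * n) = 0 := by
  have hn' : ¬ (q : ℤ) ∣ (n : ℤ) := by rwa [Int.natCast_dvd_natCast]
  rw [flipMoment_cexp_eq q hq2 σ ω₀ hM hD y c hyc n, if_neg (fun h ↦ hn' ((dvd_pow_self (q : ℤ) two_ne_zero).trans h)),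
    if_neg hn']

/-- **T3 (D)'s second input: the value on the `q`-progression.** For `q ∤ u`:
`S(q·u) = (q/2)·(1 + σ·q·J(−u | q))` — i.e. `(q/2)(1 + q*)` on the Legendre class `J(u|q) = σ` and `(q/2)(1 − q*)` on the
opposite class, `q* = J(−1|q)·q` (LEAD g14 §2.1). -/
theorem flipMoment_cexp_mul_eq (hq2 : q ≠ 2) (σ : ℤ) (ω₀ : SL(2, ℤ)) {M d₀ : ℤ} (hM : ω₀ 1 0 = M)
    (hD : ω₀ 1 1 = (q : ℤ) ^ 4 * d₀) (y c : ZMod (q ^ 2) → ℤ)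
    (hyc : ∀ j : ZMod (q ^ 2), IsUnit j → ω₀ 0 1 - y j * (j.val : ℤ) * M = (q : ℤ) ^ 2 * c j) {u : ℕ} (hu : ¬ q ∣ u) :
    ∑ j ∈ Finset.univ.filter (fun j : ZMod (q ^ 2) ↦ IsUnit j),
        ((if (q : ℤ) ∣ (j.val : ℤ) then ((q : ℂ) - 1) else -1) + σ * J(-(j.val : ℤ) | q) *
          gaussSum ((quadraticChar (ZMod q)).ringHomComp (Int.castRingHom ℂ)) (ZMod.stdAddChar (N := q))) / 2 *
          cexp (2 * π * I * ((y j : ℂ) / (q : ℂ) ^ 2) * ((q * u : ℕ) : ℂ)) =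
      (q : ℂ) * (1 + σ * q * J(-(u : ℤ) | q)) / 2 := by
  have hqp : q.Prime := Fact.out
  have hqz : (q : ℤ) ≠ 0 := Nat.cast_ne_zero.mpr hqp.ne_zero
  have hu' : ¬ (q : ℤ) ∣ (u : ℤ) := by rwa [Int.natCast_dvd_natCast]
  rw [flipMoment_cexp_eq q hq2 σ ω₀ hM hD y c hyc (q * u)]
  push_cast
  rw [if_neg (by rw [pow_two, mul_dvd_mul_iff_left hqz]; exact hu'), if_pos (dvd_mul_right _ _),
    Int.mul_ediv_cancel_left _ hqz]

/-- **The cut identity with a natural-number index** (the shape of `q`-expansion coefficients; T4 file 3 / T5 cut side):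
`∑_{j mod q²} (h_σ(j)/q²)·ψ_{q²}(j·n) = 1` iff `q ∣ n`, `q² ∤ n` and `J(n/q | q) = σ` (natural-number division), else `0`. -/
theorem sum_legendreClassWeight_mul_stdAddChar_sq_nat (hq2 : q ≠ 2) {σ : ℤ} (hσ : σ = 1 ∨ σ = -1) (n : ℕ) :
    ∑ j : ZMod (q ^ 2), ((if (q : ℤ) ∣ (j.val : ℤ) then ((q : ℂ) - 1) else -1) + σ * J(-(j.val : ℤ) | q) *
        gaussSum ((quadraticChar (ZMod q)).ringHomComp (Int.castRingHom ℂ)) (ZMod.stdAddChar (N := q))) / 2 /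
        (q : ℂ) ^ 2 * ZMod.stdAddChar (j * (n : ZMod (q ^ 2))) =
      if q ∣ n ∧ ¬ q ^ 2 ∣ n ∧ J(((n / q : ℕ) : ℤ) | q) = σ then 1 else 0 := by
  have h := sum_legendreClassWeight_mul_stdAddChar_sq q hq2 hσ (n : ℤ)
  rw [Int.cast_natCast] at h
  rw [h]
  have e1 : ((q : ℤ) ∣ (n : ℤ)) ↔ q ∣ n := Int.natCast_dvd_natCast
  have e2 : ((q : ℤ) ^ 2 ∣ (n : ℤ)) ↔ q ^ 2 ∣ n := by rw [← Int.natCast_pow]; exact Int.natCast_dvd_natCast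
  have e3 : ((n : ℤ) / q) = ((n / q : ℕ) : ℤ) := (Int.natCast_div n q).symm
  simp only [e1, e2, e3]

omit [Fact q.Prime] in
/-- The same value read through the class of `u`: for `q ∤ u`, `1 + σ·q·J(−u|q) = 1 + (σ·J(u|q))·(J(−1|q)·q)`, so the weight is
`1 + q*` when `J(u|q) = σ` and `1 − q*` when `J(u|q) = −σ` (`σ = ±1`). -/
theorem one_add_flipWeight_eq (σ : ℤ) (u : ℤ) :
    (1 : ℂ) + σ * q * J(-u | q) = 1 + (σ * J(u | q)) * (J(-1 | q) * q) := by
  rw [jacobiSym_neg_left' q u]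
  push_cast
  ring

end Summit.BirchSwinnertonDyer.BirchSwinnertonDyer.Theorems.PrintCFram.FlipRung

end
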